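import Mathlib
import HarnessLib
import Summits.HubbardSuperconductivity.HubbardSuperconductivity.Theorems.WeakCouplingBCSKlThirdOrderChainParity
import Summits.HubbardSuperconductivity.HubbardSuperconductivity.Theorems.ChiralWindowCwKLChiralWindowLindhardD4
import Summits.HubbardSuperconductivity.HubbardSuperconductivity.Theorems.KLProgrammeFermiSurfaceEnvelope

/-!
# Route `WeakCouplingBCS` — channel-margin lane of `WcbcsKohnLuttingerB1g` (stmt-HubbardSuperconductivity-0158):
# inversion symmetry of Brillouin-zone integrals; the crossed particle–particle kernel `T_P` on parity-definite states;
# symmetry of the third-order kernel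

Continues `Theorems/WeakCouplingBCSKlThirdOrderChainParity.lean` (inversion invariance of the Fermi-curve measure) with the
BULK counterpart: `p ↦ -p` preserves Lebesgue measure and maps the half-open Brillouin zone `[-π,π)²` onto `(-π,π]²`, which
agrees with it up to a null set, so `∫_{BZ} f(-p) dp = ∫_{BZ} f(p) dp` for every integrand (no integrability needed; the
tree's `kl_ld4_*` machinery of `ChiralWindowCwKLChiralWindowLindhardD4.lean` for `rot`, composed twice).  Consequences for the
objects of `Theorems/WeakCouplingBCSDefsKlThirdOrder.lean` (band `ε₀ = squareDispersion 1 0`, even: the tree's `klfs_squareDispersion_neg`):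

* `lindhardFunction_neg`: `χ₀(-q) = χ₀(q)`; hence `chainKernel3` and the full third-order kernel `K₃ = klThirdOrderKernel` are
  SYMMETRIC kernels (`chainKernel3_comm`, `twoLoopV_comm`, `twoLoopP_comm`, `klThirdOrderKernel_comm`; `jV`, `jOcc`, `jEmp`,
  `psiV`, `psiP` are symmetric in the two outer energies);
* `psiP_neg`: `Ψ_P(-u; a, b) = Ψ_P(u; a, b)` (the pair-measure integrand at total momentum `-u`);
* **the crossed kernel on parity-definite states** (cell file U0-TABLE.md v0 §1, v3.1 §2; REF-CHECK §187 (R-hyp), so far a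
  hand-check): `T_P(-k, k') = (2π)⁻² ∫_{BZ} [A(u) + A(-u)] du` with `A(u) = Ψ_P(u; ξ(u-k), ξ(u-k'))` (`twoLoopP_neg_left`), hence
  for even `ψ`: `⟨ψ, T_P ψ⟩ = ⟨ψ, S_P^{sym} ψ⟩` and for odd `ψ`: `⟨ψ, T_P ψ⟩ = -⟨ψ, S_P^{sym} ψ⟩`, where
  `S_P^{sym}(k,k') = (2π)⁻² ∫_{BZ} [A(u) + A(-u)] du` is the `u`-symmetrised "same-side" crossed kernel
  (`kform_twoLoopP_of_even/_of_odd`, hypothesis-free); if `A` is integrable on the zone this is the kernel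
  `S_P(k,k') = 2 (2π)⁻² ∫_{BZ} Ψ_P(u; ξ(u-k), ξ(u-k')) du` of the cell files (`twoLoopP_neg_left_of_integrableOn`).

Everything is proved; no definition (the kernels `S_P^{sym}`, `S_P` are written inline); nothing here asserts a pairing
instability.  References: Raghu–Kivelson–Scalapino 2010 App. A (diagrams (3b)–(3c)).
-/

noncomputable section

-- the tree's namespace `Summit.<Summit>.<Problem>.Theorems` repeats the summit name by design (D-0017)
set_option linter.dupNamespace false

namespace Summit.HubbardSuperconductivity.HubbardSuperconductivity.Theorems

open MeasureTheory Literature.MathematicalPhysics.QuantumLattice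

namespace KlThirdOrder

/-! ### Inversion symmetry in the bulk: the band, Lebesgue measure, the Brillouin zone -/

-- the band is even: `ε₀(-k) = ε₀(k)` is the tree's `klfs_squareDispersion_neg 1 0`.

/-- **The Lindhard function of `ε₀` is even**: `χ₀(-q) = χ₀(q)` (`-id = rot² ∈ D₄`, `stub_klLindhardD4`). [folklore] -/
theorem lindhardFunction_neg (μ : ℝ) (q : Momentum) :
    lindhardFunction (squareDispersion 1 0) μ (-q) = lindhardFunction (squareDispersion 1 0) μ q := by
  rw [← CwKLChiralWindow.Negative.rot_rot]
  exact kl_ld4_lindhard_rot_iterate μ 2 q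

/-- `p ↦ -p` is a volume-preserving measurable embedding of momentum space. [folklore] -/
theorem measurePreserving_neg_volume :
    MeasurePreserving (fun p : Momentum => -p) (volume : Measure Momentum) volume ∧
      MeasurableEmbedding (fun p : Momentum => -p) := by
  have h := kl_ld4_rot_measurePreserving
  have hfun : (fun p : Momentum => -p) = rotMomentum ∘ rotMomentum :=
    funext fun k => (CwKLChiralWindow.Negative.rot_rot k).symm
  rw [hfun]
  exact ⟨h.1.comp h.1, h.2.comp h.2⟩

/-- `-BZ = (-π,π]²` agrees with the half-open Brillouin zone `[-π,π)²` up to a Lebesgue-null set. [folklore] -/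
theorem neg_preimage_brillouinZone_ae_eq :
    (fun p : Momentum => -p) ⁻¹' brillouinZone =ᵐ[(volume : Measure Momentum)] brillouinZone := by
  have h1 : (fun p : Momentum => -p) ⁻¹' brillouinZone =
      (fun k : Momentum => ((k 0, k 1) : ℝ × ℝ)) ⁻¹' (Set.Ioc (-Real.pi) Real.pi ×ˢ Set.Ioc (-Real.pi) Real.pi) := by
    ext k
    simp only [Set.mem_preimage, brillouinZone, Set.mem_setOf_eq, Fin.forall_fin_two, Set.mem_prod, Set.mem_Ico,
      Set.mem_Ioc, PiLp.neg_apply]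
    constructor
    · rintro ⟨⟨h1, h2⟩, h3, h4⟩
      exact ⟨⟨by linarith, by linarith⟩, by linarith, by linarith⟩
    · rintro ⟨⟨h1, h2⟩, h3, h4⟩
      exact ⟨⟨by linarith, by linarith⟩, by linarith, by linarith⟩
  have h2 : brillouinZone = (fun k : Momentum => ((k 0, k 1) : ℝ × ℝ)) ⁻¹'
      (Set.Ico (-Real.pi) Real.pi ×ˢ Set.Ico (-Real.pi) Real.pi) := by
    ext k
    simp [brillouinZone, Fin.forall_fin_two]
  rw [h1, h2]
  refine measurePreserving_momentum_prod.quasiMeasurePreserving.preimage_ae_eq ?_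
  rw [show (volume : Measure (ℝ × ℝ)) = (volume : Measure ℝ).prod volume from rfl]
  exact Measure.set_prod_ae_eq Ico_ae_eq_Ioc.symm Ico_ae_eq_Ioc.symm

/-- **Inversion symmetry of Brillouin-zone integrals**: `∫_{BZ} f(-p) dp = ∫_{BZ} f(p) dp` for every integrand (no
integrability needed). [folklore] -/
theorem setIntegral_brillouinZone_comp_neg (f : Momentum → ℝ) :
    ∫ p in brillouinZone, f (-p) = ∫ p in brillouinZone, f p := by
  obtain ⟨hT, hTe⟩ := measurePreserving_neg_volume
  calc ∫ p in brillouinZone, f (-p)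
      = ∫ p in (fun p : Momentum => -p) ⁻¹' brillouinZone, f (-p) :=
        (setIntegral_congr_set neg_preimage_brillouinZone_ae_eq).symm
    _ = ∫ p in brillouinZone, f p := hT.setIntegral_preimage_emb hTe f brillouinZone

/-- A function integrable on the zone stays integrable after `p ↦ -p`. [folklore] -/
theorem integrableOn_brillouinZone_comp_neg {f : Momentum → ℝ} (hf : IntegrableOn f brillouinZone) :
    IntegrableOn (fun p => f (-p)) brillouinZone := by
  obtain ⟨hT, hTe⟩ := measurePreserving_neg_volume
  have h : IntegrableOn (f ∘ fun p : Momentum => -p) ((fun p : Momentum => -p) ⁻¹' brillouinZone) volume :=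
    (hT.integrableOn_comp_preimage hTe).2 hf
  exact h.congr_set_ae neg_preimage_brillouinZone_ae_eq.symm

/-! ### Symmetry of the frequency-integral case tables and of the kernels -/

/-- `J_V(D; a, b) = J_V(D; b, a)`. [folklore] -/
theorem jV_comm (D a b : ℝ) : jV D a b = jV D b a := by
  unfold jV
  by_cases h : 0 < a * b
  · have h' : 0 < b * a := by rwa [mul_comm] at h
    rw [if_pos h, if_pos h']
    ring
  · have h' : ¬(0 < b * a) := by rwa [mul_comm] at h
    rw [if_neg h, if_neg h']
    ring

/-- `J_occ(E; a, b) = J_occ(E; b, a)`. [folklore] -/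
theorem jOcc_comm (E a b : ℝ) : jOcc E a b = jOcc E b a := by
  unfold jOcc
  by_cases h1 : 0 < a ∧ 0 < b
  · have h1' : 0 < b ∧ 0 < a := ⟨h1.2, h1.1⟩
    rw [if_pos h1, if_pos h1']
    ring
  · have h1' : ¬(0 < b ∧ 0 < a) := fun h => h1 ⟨h.2, h.1⟩
    rw [if_neg h1, if_neg h1']
    by_cases h2 : a * b < 0
    · have h2' : b * a < 0 := by rwa [mul_comm] at h2
      rw [if_pos h2, if_pos h2', max_comm, add_comm |a| |b|]
    · have h2' : ¬(b * a < 0) := by rwa [mul_comm] at h2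
      rw [if_neg h2, if_neg h2']

/-- `J_emp(E; a, b) = J_emp(E; b, a)`. [folklore] -/
theorem jEmp_comm (E a b : ℝ) : jEmp E a b = jEmp E b a := by
  unfold jEmp
  by_cases h1 : a < 0 ∧ b < 0
  · have h1' : b < 0 ∧ a < 0 := ⟨h1.2, h1.1⟩
    rw [if_pos h1, if_pos h1']
    ring
  · have h1' : ¬(b < 0 ∧ a < 0) := fun h => h1 ⟨h.2, h.1⟩
    rw [if_neg h1, if_neg h1']
    by_cases h2 : a * b < 0
    · have h2' : b * a < 0 := by rwa [mul_comm] at h2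
      rw [if_pos h2, if_pos h2', min_comm, add_comm |a| |b|]
    · have h2' : ¬(b * a < 0) := by rwa [mul_comm] at h2
      rw [if_neg h2, if_neg h2']

/-- `Ψ_V(u; a, b) = Ψ_V(u; b, a)`. [folklore] -/
theorem psiV_comm (ε : Momentum → ℝ) (μ : ℝ) (u : Momentum) (a b : ℝ) : psiV ε μ u a b = psiV ε μ u b a := by
  unfold psiV
  congr 1
  congr 1
  funext p
  rw [jV_comm]

/-- `Ψ_P(u; a, b) = Ψ_P(u; b, a)`. [folklore] -/
theorem psiP_comm (ε : Momentum → ℝ) (μ : ℝ) (u : Momentum) (a b : ℝ) : psiP ε μ u a b = psiP ε μ u b a := by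
  unfold psiP
  congr 1
  congr 1
  funext q
  rw [jOcc_comm, jEmp_comm]

/-- **`Ψ_P` is even in the total momentum** for the even band `ε₀`: `Ψ_P(-u; a, b) = Ψ_P(u; a, b)` (substitute `q ↦ -q` in the
pair integral; the zone is inversion-symmetric a.e.). [folklore] -/
theorem psiP_neg (μ : ℝ) (u : Momentum) (a b : ℝ) :
    psiP (squareDispersion 1 0) μ (-u) a b = psiP (squareDispersion 1 0) μ u a b := by
  unfold psiP
  congr 1
  rw [← setIntegral_brillouinZone_comp_neg (fun q =>
    (if squareDispersion 1 0 q < μ ∧ squareDispersion 1 0 (-u - q) < μ then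
        jOcc (2 * μ - squareDispersion 1 0 q - squareDispersion 1 0 (-u - q)) a b else 0) +
      (if μ < squareDispersion 1 0 q ∧ μ < squareDispersion 1 0 (-u - q) then
        jEmp (squareDispersion 1 0 q + squareDispersion 1 0 (-u - q) - 2 * μ) a b else 0))]
  congr 1
  funext q
  have h1 : squareDispersion 1 0 (-q) = squareDispersion 1 0 q := klfs_squareDispersion_neg 1 0 q
  have h2 : squareDispersion 1 0 (-u - -q) = squareDispersion 1 0 (u - q) := by
    rw [show -u - -q = -(u - q) by abel, klfs_squareDispersion_neg]
  simp only [h1, h2]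

/-- `T_V` is a symmetric kernel. [folklore] -/
theorem twoLoopV_comm (ε : Momentum → ℝ) (μ : ℝ) (k k' : Momentum) : twoLoopV ε μ k k' = twoLoopV ε μ k' k := by
  unfold twoLoopV
  congr 1
  congr 1
  congr 1
  funext u
  rw [psiV_comm]

/-- `T_P` is a symmetric kernel (it is symmetrised by definition). [folklore] -/
theorem twoLoopP_comm (ε : Momentum → ℝ) (μ : ℝ) (k k' : Momentum) : twoLoopP ε μ k k' = twoLoopP ε μ k' k := by
  unfold twoLoopP
  congr 1
  congr 1
  funext u
  rw [add_comm]

/-- The chain kernel of `ε₀` is symmetric (`χ₀` is even). [folklore] -/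
theorem chainKernel3_comm (μ : ℝ) (k k' : Momentum) :
    chainKernel3 (squareDispersion 1 0) μ k k' = chainKernel3 (squareDispersion 1 0) μ k' k := by
  simp only [chainKernel3]
  rw [show k' - k = -(k - k') by abel, lindhardFunction_neg, add_comm k' k]

/-- **The third-order kernel `K₃` of `ε₀` is symmetric**: `K₃(k, k') = K₃(k', k)`. [folklore] -/
theorem klThirdOrderKernel_comm (μ : ℝ) (k k' : Momentum) :
    klThirdOrderKernel (squareDispersion 1 0) μ k k' = klThirdOrderKernel (squareDispersion 1 0) μ k' k := by
  simp only [klThirdOrderKernel]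
  rw [chainKernel3_comm, twoLoopV_comm, twoLoopP_comm]

/-! ### The crossed kernel reflected in one argument -/

/-- **`T_P(-k, k')` is the `u`-symmetrised same-side crossed kernel**:
`T_P(-k, k') = (2π)⁻² ∫_{BZ} [A(u) + A(-u)] du`, `A(u) = Ψ_P(u; ξ(u-k), ξ(u-k'))` — the second (mirror) term of `T_P` is the first
one at `-u` (`Ψ_P` even in `u`, symmetric in the outer energies, `ε₀` even).  Hypothesis-free. [cite: RaghuKivelsonScalapino2010, App. A (3b)] -/
theorem twoLoopP_neg_left (μ : ℝ) (k k' : Momentum) :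
    twoLoopP (squareDispersion 1 0) μ (-k) k' =
      (∫ u in brillouinZone,
        (psiP (squareDispersion 1 0) μ u (squareDispersion 1 0 (u - k) - μ) (squareDispersion 1 0 (u - k') - μ) +
          psiP (squareDispersion 1 0) μ (-u) (squareDispersion 1 0 (-u - k) - μ)
            (squareDispersion 1 0 (-u - k') - μ))) / (2 * Real.pi) ^ 2 := by
  unfold twoLoopP
  congr 1
  congr 1
  funext u
  have h1 : u + -k = u - k := by abel
  have h2 : squareDispersion 1 0 (u - -k) = squareDispersion 1 0 (-u - k) := by
    rw [show u - -k = -(-u - k) by abel, klfs_squareDispersion_neg]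
  have h3 : squareDispersion 1 0 (u + k') = squareDispersion 1 0 (-u - k') := by
    rw [show u + k' = -(-u - k') by abel, klfs_squareDispersion_neg]
  rw [h1, h2, h3, psiP_comm (squareDispersion 1 0) μ u (squareDispersion 1 0 (-u - k') - μ),
    ← psiP_neg μ u (squareDispersion 1 0 (-u - k) - μ) (squareDispersion 1 0 (-u - k') - μ)]

/-- With integrability of `A` on the zone the symmetrisation collapses: `T_P(-k, k') = 2 (2π)⁻² ∫_{BZ} Ψ_P(u; ξ(u-k), ξ(u-k')) du`
— the kernel `S_P` of the cell files. [cite: RaghuKivelsonScalapino2010, App. A (3b)] -/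
theorem twoLoopP_neg_left_of_integrableOn (μ : ℝ) (k k' : Momentum)
    (hA : IntegrableOn (fun u => psiP (squareDispersion 1 0) μ u (squareDispersion 1 0 (u - k) - μ)
      (squareDispersion 1 0 (u - k') - μ)) brillouinZone) :
    twoLoopP (squareDispersion 1 0) μ (-k) k' =
      2 * (∫ u in brillouinZone,
        psiP (squareDispersion 1 0) μ u (squareDispersion 1 0 (u - k) - μ) (squareDispersion 1 0 (u - k') - μ)) /
          (2 * Real.pi) ^ 2 := by
  rw [twoLoopP_neg_left]
  congr 1
  have hB := integrableOn_brillouinZone_comp_neg hA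
  rw [integral_add hA hB, setIntegral_brillouinZone_comp_neg (fun u =>
    psiP (squareDispersion 1 0) μ u (squareDispersion 1 0 (u - k) - μ) (squareDispersion 1 0 (u - k') - μ))]
  ring

/-! ### Outer reflection of a kernel form and `T_P` on parity-definite states -/

/-- Reflecting the OUTER variable: on even `ψ`, `⟨ψ, T ψ⟩ = ⟨ψ, T(-·, ·) ψ⟩` (`σ_μ` inversion-invariant, `μ < 0`). [folklore] -/
theorem kform_eq_kform_neg_left_of_even {μ : ℝ} (hμ : μ < 0) (T : Momentum → Momentum → ℝ) {ψ : Momentum → ℝ}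
    (heven : ∀ k, ψ (-k) = ψ k) :
    kform (fermiCurveMeasure (squareDispersion 1 0) μ) T ψ =
      kform (fermiCurveMeasure (squareDispersion 1 0) μ) (fun k k' => T (-k) k') ψ := by
  unfold kform
  rw [← integral_comp_neg_fermiCurveMeasure hμ (fun k => ψ k *
    ∫ k', T k k' * ψ k' ∂fermiCurveMeasure (squareDispersion 1 0) μ)]
  congr 1
  funext k
  rw [heven]

/-- Reflecting the OUTER variable: on odd `ψ`, `⟨ψ, T ψ⟩ = -⟨ψ, T(-·, ·) ψ⟩`. [folklore] -/
theorem kform_eq_neg_kform_neg_left_of_odd {μ : ℝ} (hμ : μ < 0) (T : Momentum → Momentum → ℝ) {ψ : Momentum → ℝ}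
    (hodd : ∀ k, ψ (-k) = -ψ k) :
    kform (fermiCurveMeasure (squareDispersion 1 0) μ) T ψ =
      -kform (fermiCurveMeasure (squareDispersion 1 0) μ) (fun k k' => T (-k) k') ψ := by
  unfold kform
  rw [← integral_comp_neg_fermiCurveMeasure hμ (fun k => ψ k *
    ∫ k', T k k' * ψ k' ∂fermiCurveMeasure (squareDispersion 1 0) μ), ← integral_neg]
  congr 1
  funext k
  rw [hodd]
  ring

/-- **`⟨ψ, T_P ψ⟩ = ⟨ψ, S_P^{sym} ψ⟩` on EVEN gap functions** (`μ < 0`), with the `u`-symmetrised same-side crossed kernel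
`S_P^{sym}(k,k') = (2π)⁻² ∫_{BZ} [Ψ_P(u; ξ(u-k), ξ(u-k')) + Ψ_P(-u; ξ(-u-k), ξ(-u-k'))] du` written inline.  Hypothesis-free.
[cite: RaghuKivelsonScalapino2010, App. A (3b)] -/
theorem kform_twoLoopP_of_even {μ : ℝ} (hμ : μ < 0) {ψ : Momentum → ℝ} (heven : ∀ k, ψ (-k) = ψ k) :
    kform (fermiCurveMeasure (squareDispersion 1 0) μ) (twoLoopP (squareDispersion 1 0) μ) ψ =
      kform (fermiCurveMeasure (squareDispersion 1 0) μ) (fun k k' =>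
        (∫ u in brillouinZone,
          (psiP (squareDispersion 1 0) μ u (squareDispersion 1 0 (u - k) - μ) (squareDispersion 1 0 (u - k') - μ) +
            psiP (squareDispersion 1 0) μ (-u) (squareDispersion 1 0 (-u - k) - μ)
              (squareDispersion 1 0 (-u - k') - μ))) / (2 * Real.pi) ^ 2) ψ := by
  rw [kform_eq_kform_neg_left_of_even hμ _ heven]
  simp only [twoLoopP_neg_left]

/-- **`⟨ψ, T_P ψ⟩ = -⟨ψ, S_P^{sym} ψ⟩` on ODD gap functions** (the `E` channel; `μ < 0`).  Hypothesis-free.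
[cite: RaghuKivelsonScalapino2010, App. A (3b)] -/
theorem kform_twoLoopP_of_odd {μ : ℝ} (hμ : μ < 0) {ψ : Momentum → ℝ} (hodd : ∀ k, ψ (-k) = -ψ k) :
    kform (fermiCurveMeasure (squareDispersion 1 0) μ) (twoLoopP (squareDispersion 1 0) μ) ψ =
      -kform (fermiCurveMeasure (squareDispersion 1 0) μ) (fun k k' =>
        (∫ u in brillouinZone,
          (psiP (squareDispersion 1 0) μ u (squareDispersion 1 0 (u - k) - μ) (squareDispersion 1 0 (u - k') - μ) +
            psiP (squareDispersion 1 0) μ (-u) (squareDispersion 1 0 (-u - k) - μ)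
              (squareDispersion 1 0 (-u - k') - μ))) / (2 * Real.pi) ^ 2) ψ := by
  rw [kform_eq_neg_kform_neg_left_of_odd hμ _ hodd]
  simp only [twoLoopP_neg_left]

/-- **With integrability: `⟨ψ, T_P ψ⟩ = ±⟨ψ, S_P ψ⟩`**, `S_P(k,k') = 2 (2π)⁻² ∫_{BZ} Ψ_P(u; ξ(u-k), ξ(u-k')) du` (the cell files'
same-side crossed kernel), `+` on even and `-` on odd gap functions, provided `u ↦ Ψ_P(u; ξ(u-k), ξ(u-k'))` is integrable on the zone for
all `k, k'`. [cite: RaghuKivelsonScalapino2010, App. A (3b)] -/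
theorem kform_twoLoopP_parity {μ : ℝ} (hμ : μ < 0) {ψ : Momentum → ℝ} {s : ℝ}
    (hpar : (s = 1 ∧ ∀ k, ψ (-k) = ψ k) ∨ (s = -1 ∧ ∀ k, ψ (-k) = -ψ k))
    (hA : ∀ k k' : Momentum, IntegrableOn (fun u => psiP (squareDispersion 1 0) μ u (squareDispersion 1 0 (u - k) - μ)
      (squareDispersion 1 0 (u - k') - μ)) brillouinZone) :
    kform (fermiCurveMeasure (squareDispersion 1 0) μ) (twoLoopP (squareDispersion 1 0) μ) ψ =
      s * kform (fermiCurveMeasure (squareDispersion 1 0) μ) (fun k k' =>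
        2 * (∫ u in brillouinZone,
          psiP (squareDispersion 1 0) μ u (squareDispersion 1 0 (u - k) - μ) (squareDispersion 1 0 (u - k') - μ)) /
            (2 * Real.pi) ^ 2) ψ := by
  have hker : (fun k k' => twoLoopP (squareDispersion 1 0) μ (-k) k') = fun k k' =>
      2 * (∫ u in brillouinZone,
        psiP (squareDispersion 1 0) μ u (squareDispersion 1 0 (u - k) - μ) (squareDispersion 1 0 (u - k') - μ)) /
          (2 * Real.pi) ^ 2 := by
    funext k k'
    exact twoLoopP_neg_left_of_integrableOn μ k k' (hA k k')
  rcases hpar with ⟨hs, heven⟩ | ⟨hs, hodd⟩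
  · rw [kform_eq_kform_neg_left_of_even hμ _ heven, hker, hs, one_mul]
  · rw [kform_eq_neg_kform_neg_left_of_odd hμ _ hodd, hker, hs, neg_one_mul]

end KlThirdOrder

end Summit.HubbardSuperconductivity.HubbardSuperconductivity.Theorems

end
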